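import Summits.BirchSwinnertonDyer.Rank1Residual.X11b.AnticyclotomicSplitPlaces
import Literature.NumberTheory.GaloisRepresentations.FrobeniusPlaces
import Literature.NumberTheory.EllipticCurves.ComplexMultiplicationDeuringLocalPlaces
import Literature.NumberTheory.Automorphic.QuadraticCharacterTwist
import HarnessLib

/-!
# X11b, route R1 — places over primes RAMIFIED in the quadratic field split completely in the
# anticyclotomic tower (dihedral inertia argument): the decomposition group lies in `ker κ`

HONEST FRAMING (cell `b2b-bsdres`, run/shared/lean/b2b/bsd-rank1-residual/, verbatim in every
file): the goal of the cell is to DELETE the COMBINATION-SHAPED residual classes of the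
Birch–Swinnerton-Dyer formula for ALL analytic-rank `≤ 1` elliptic curves over `ℚ` — "full BSD
formula for every rank `≤ 1` curve in class `C`" assembled STRICTLY from published theorems — so
that the rank-`≤ 1` remainder becomes exactly the CONSTRUCTION-SHAPED classes, which are TYPED
(missing-input `Prop`s), NOT attempted. This is not "finishing BSD". Sub-cell
`b2b-bsdres-multr1-p1` (X11b, route R1 = Castella 2018 Thm. A re-proved along the author's
erratum); a RESEARCH ROUTE; no claim beyond the stated class; X11b stays CONSTRUCTION-SHAPED;
nothing here changes a label; no named fact is minted (proved theorems only; no `sorry`).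

## Why this file

For the control theorem of route R1 (Cas18 Thm. 2.3 ⇐ JSW17 §3.3 on Castella's constructed Selmer
group) the local kernels `ker(H¹(K_v, E[p^∞]) → H¹(K_{∞,w}, E[p^∞]))` at the finite `v ∤ p` must be
controlled. They vanish where `v` splits completely in `K_∞` (`AnticyclotomicControlCokernel`), at
every GOOD `v` (`AnticyclotomicGoodPlaces`), and at the places over primes INERT in `K`
(`AnticyclotomicInertPlaces`). On an erratum field the remaining BAD place is the one above the
RAMIFIED multiplicative prime `q` (`q ∣ d_K`). This file proves that the places over primes ramified
in the quadratic field `K` also SPLIT COMPLETELY in the anticyclotomic `ℤ_p`-extension, so their local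
kernels vanish too and Castella's away condition descends there — which is why Cas18's Tamagawa
term is `∏_{w ∣ N⁺} c_w^{(p)}` over the SPLIT bad primes only.

The argument (`Gal(K_∞/ℚ) = Γ ⋊ ⟨c⟩` dihedral; Brink, Math. Comp. 76 (2007) §1; Greenberg LNM 1716
§3 p. 87): let `𝔔 ∣ v` be a prime of `\bar ℤ_K`, `𝔓 = 𝔔 ∩ \bar ℤ_ℚ`, `φ ∈ Γ_K` a Frobenius at `𝔔`.
* `exists_mem_inertia_not_mem_range_of_ramificationIdx_eq_two`: if `e(v|ℓ) = 2` there is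
  `y ∈ I_𝔓(Γ_ℚ)` NOT in `H = res(Γ_K)`. (Otherwise `I_𝔓 ≤ H`; since `f(v|ℓ) = 1` the restriction of
  `φ` is a Frobenius at `𝔓` lying in `H`, so `D_𝔓 = ⟨res φ⟩·I_𝔓·H ≤ H` (Frobenius generation, `H`
  open); but `v` is the ONLY place above `ℓ`, so for `c ∉ H` the prime `c𝔓` is `Γ_K`-conjugate to
  `𝔓` through `H`, forcing `c ∈ D_𝔓·H = H` — contradiction. Inputs: the tree's quadratic
  trichotomy `placesOver_trichotomy_of_finrank_eq_two`, the `\bar ℤ_ℚ ≅ \bar ℤ_K` dictionary of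
  `AbsIntegersEquiv`/`FrobeniusPlaces`, transitivity `exists_smul_eq_of_mem_primesAbove_holds`.)
* `IsAnticyclotomic.apply_eq_one_of_ramificationIdx_eq_two`: for anticyclotomic `κ` and `v ∤ p`
  ramified over `ℚ`, `κ φ = 1`: with `y` as above, `y·res φ·y⁻¹ = res φ'` (`H` normal of index `2`),
  `κ φ' = (κ φ)⁻¹` (anticyclotomic relation), and `res(φ'φ⁻¹) = y·(res φ·y⁻¹·res φ⁻¹) ∈ I_𝔓`
  (inertia is normalised by the decomposition group), so `φ'φ⁻¹ ∈ I_𝔔 ≤ ker κ` (`v ∤ p`): `κ φ = κ φ'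
  = (κ φ)⁻¹`, i.e. `κ φ = 1` in the torsion-free `ℤ_p`.
* **`IsAnticyclotomic.decomp_le_kerSubgroup_of_ramificationIdx_eq_two`** (`D_v ≤ ker κ`) and
  **`IsAnticyclotomic.resOfLe_mem_awayKer_iff_of_ramificationIdx_eq_two`** (the away condition at
  such `v` descends, any discrete `Γ_K`-module).

References: [GreenbergLNM1716] §3 p. 87; [Washington1997] §13; [NeukirchANT1999] I §9 (9.4)–(9.6);
Brink, *Prime decomposition in the anti-cyclotomic extension*, Math. Comp. 76 (2007), §1.
-/

noncomputable section

open scoped Classical Pointwise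

open NumberField IsDedekindDomain Field
open Literature.NumberTheory.EllipticCurves Literature.NumberTheory.EllipticCurves.GreenbergSelmer
open Literature.NumberTheory.GaloisRepresentations IsDedekindDomain.HeightOneSpectrum

namespace Summit.BirchSwinnertonDyer.Rank1Residual.X11b.AcSelmer

/-! ## Inertia is normalised by the decomposition group -/

section Inertia

variable {A : Type*} [CommRing A] {G : Type*} [Group G] [MulSemiringAction G A] {𝔓 : Ideal A}

/-- `d ∈ D_𝔓`, `y ∈ I_𝔓` ⟹ `d y d⁻¹ ∈ I_𝔓` (`(dyd⁻¹)x − x = d(y(d⁻¹x) − d⁻¹x) ∈ d𝔓 = 𝔓`).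
[cite: NeukirchANT1999, Ch. I §9 (9.6) (`I_𝔓` normal in `G_𝔓`)] -/
theorem conj_mem_inertia_of_mem_decompositionSubgroup {d y : G}
    (hd : d ∈ 𝔓.decompositionSubgroup G) (hy : y ∈ 𝔓.inertia G) : d * y * d⁻¹ ∈ 𝔓.inertia G := by
  intro x
  rw [Ideal.mem_decompositionSubgroup_iff] at hd
  change (d * y * d⁻¹) • x - x ∈ 𝔓
  rw [← hd, Ideal.mem_pointwise_smul_iff_inv_smul_mem, smul_sub, ← mul_smul, ← mul_assoc,
    ← mul_assoc, inv_mul_cancel, one_mul, mul_smul]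
  exact hy (d⁻¹ • x)

end Inertia

section Helper

variable {G X : Type*} [Group G] [MulAction G X]

/-- `a • b • x = x ⟹ a·b ∈ Stab(x)` (recorded with the action as a hypothesis, so that no pointwise
instance on ideals has to be synthesised at the call site). [folklore] -/
theorem mul_mem_stabilizer_of_smul_smul_eq {x : X} {a b : G} (h : a • b • x = x) :
    a * b ∈ MulAction.stabilizer G x := by
  rw [MulAction.mem_stabilizer_iff, mul_smul]
  exact h

end Helper

variable {K : Type} [Field K] [NumberField K]

/-! ## A ramified place of a quadratic field: an inertia element moving `K` -/

/-- **At a place `v` of a quadratic field with `e(v|ℓ) = 2` some element of the inertia group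
`I_𝔓(Γ_ℚ)` (`𝔓 = 𝔔 ∩ \bar ℤ_ℚ`, `𝔔 ∣ v`) is NOT in `res(Γ_K)`** — "inertia surjects onto
`I(v|ℓ) = Gal(K/ℚ)`". Proof by contradiction: if `I_𝔓 ≤ H = res(Γ_K)` then, `f(v|ℓ)` being `1`, the
restriction of a Frobenius of `Γ_K` at `𝔔` is a Frobenius at `𝔓` in `H` and Frobenius generation gives
`D_𝔓 ≤ H`; as `v` is the only place of `K` above `ℓ`, any `c ∉ H` satisfies `res(h)·c ∈ D_𝔓` for some
`h ∈ Γ_K` (transitivity on the primes of `\bar ℤ_K` above `v`), whence `c ∈ H`.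
[cite: NeukirchANT1999, Ch. I §9 Prop. (9.4)–(9.6)] [cite: Marcus2018, Ch. 4, Thm. 28–29] -/
theorem exists_mem_inertia_not_mem_range_of_ramificationIdx_eq_two (hK : Module.finrank ℚ K = 2)
    {v : HeightOneSpectrum (𝓞 K)} (he : v.asIdeal.ramificationIdx (𝓞 ℚ) = 2)
    {𝔔 : Ideal (absIntegers (𝓞 K) K)} (h𝔔 : 𝔔 ∈ v.primesAbove) :
    ∃ y : absoluteGaloisGroup ℚ,
      y ∈ (𝔔.comap (absIntegersMap ℚ K)).inertia (absoluteGaloisGroup ℚ) ∧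
        y ∉ Set.range (absGaloisRestrict ℚ K) := by
  haveI : FiniteDimensional ℚ K := Module.finite_of_finrank_eq_succ hK
  haveI := h𝔔.1
  -- `v` is the unique place above `ℓ = v ∩ ℚ`, of residue degree `1`
  have hv : v.asIdeal.under (𝓞 ℚ) = (v.under (𝓞 ℚ)).asIdeal := rfl
  obtain ⟨hf, huniq⟩ : v.asIdeal.inertiaDeg (𝓞 ℚ) = 1 ∧
      ∀ w : HeightOneSpectrum (𝓞 K), w.under (𝓞 ℚ) = v.under (𝓞 ℚ) → w = v := by
    rcases placesOver_trichotomy_of_finrank_eq_two K hK (v.under (𝓞 ℚ)) with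
      ⟨w₁, w₂, -, -, hef⟩ | ⟨w, hset, he1, -⟩ | ⟨w, hset, -, hf1⟩
    · have := (hef v rfl).1; omega
    · have hvw : v = w := by
        have : v ∈ ({w' : HeightOneSpectrum (𝓞 K) | w'.under (𝓞 ℚ) = v.under (𝓞 ℚ)}) := rfl
        rw [hset] at this; exact this
      subst hvw; omega
    · have hvw : v = w := by
        have : v ∈ ({w' : HeightOneSpectrum (𝓞 K) | w'.under (𝓞 ℚ) = v.under (𝓞 ℚ)}) := rfl
        rw [hset] at this; exact this
      subst hvw
      refine ⟨hf1, fun w' hw' ↦ ?_⟩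
      have : w' ∈ ({w'' : HeightOneSpectrum (𝓞 K) | w''.under (𝓞 ℚ) = v.under (𝓞 ℚ)}) := hw'
      rw [hset] at this; exact this
  -- the subgroup `H = res(Γ_K)`, open of index `2`
  set H : Subgroup (absoluteGaloisGroup ℚ) := (absGaloisRestrict ℚ K).range with hH
  obtain ⟨hHopen, hHi⟩ :=
    Literature.NumberTheory.Automorphic.isOpen_range_absGaloisRestrict_and_index_eq_two ℚ K hK
  have hmemH : ∀ g : absoluteGaloisGroup ℚ, g ∈ H ↔ g ∈ Set.range (absGaloisRestrict ℚ K) :=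
    fun g ↦ by rw [hH]; exact MonoidHom.mem_range
  by_contra hall
  push Not at hall
  have hIH : (𝔔.comap (absIntegersMap ℚ K)).inertia (absoluteGaloisGroup ℚ) ≤ H :=
    fun y hy ↦ (hmemH y).mpr (hall y hy)
  -- a Frobenius of `Γ_K` at `𝔔` restricts to a Frobenius at `𝔓` (residue degree one)
  have h𝔓 : 𝔔.comap (absIntegersMap ℚ K) ∈ (v.under (𝓞 ℚ)).primesAbove :=
    comap_absIntegersMap_mem_primesAbove hv h𝔔
  obtain ⟨τ, hτ⟩ := exists_isArithFrobAt_of_mem_primesAbove_holds h𝔔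
  have hΦ : IsArithFrobAt (𝓞 ℚ) (absGaloisRestrict ℚ K τ) (𝔔.comap (absIntegersMap ℚ K)) :=
    isArithFrobAt_absGaloisRestrict_of_inertiaDeg_eq_one hv h𝔔 hτ hf
  -- hence `D_𝔓 ≤ H`
  have hDH : (𝔔.comap (absIntegersMap ℚ K)).decompositionSubgroup (absoluteGaloisGroup ℚ) ≤ H := by
    intro d hd
    obtain ⟨n, i, u, hi, hu, rfl⟩ :=
      exists_eq_frobenius_pow_mul_of_mem_decompositionSubgroup h𝔓 hΦ hHopen hd
    exact H.mul_mem (H.mul_mem (H.pow_mem ⟨τ, rfl⟩ n) (hIH hi)) hu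
  -- an element outside `H`
  obtain ⟨c, hc⟩ : ∃ c : absoluteGaloisGroup ℚ, c ∉ H := by
    by_contra h
    push Not at h
    have htop : H = ⊤ := eq_top_iff.mpr fun g _ ↦ h g
    have hHi' : H.index = 2 := hHi
    rw [htop, Subgroup.index_top] at hHi'
    omega
  -- `c • 𝔓` corresponds to a prime of `\bar ℤ_K` above the unique place `v`
  have hc𝔓 := smul_mem_primesAbove h𝔓 c
  haveI := hc𝔓.1
  obtain ⟨𝔔', h𝔔'p, h𝔔'⟩ := exists_isPrime_comap_absIntegersMap_eq ℚ K (c • 𝔔.comap (absIntegersMap ℚ K))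
  haveI := h𝔔'p
  obtain ⟨w, hwv, hw𝔔', -⟩ :=
    exists_heightOneSpectrum_of_comap_absIntegersMap_mem_primesAbove (K := ℚ) (M := K)
      (𝔔 := 𝔔') (h𝔔' ▸ hc𝔓)
  have hw : w = v := huniq w (HeightOneSpectrum.ext hwv)
  subst hw
  obtain ⟨g, hg⟩ := exists_smul_eq_of_mem_primesAbove_holds hw𝔔' h𝔔
  -- `res g • (c • 𝔓) = 𝔓`, so `res g * c ∈ D_𝔓 ≤ H` and `c ∈ H`
  have hgc : absGaloisRestrict ℚ K g * c ∈
      (𝔔.comap (absIntegersMap ℚ K)).decompositionSubgroup (absoluteGaloisGroup ℚ) :=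
    mul_mem_stabilizer_of_smul_smul_eq (by rw [← h𝔔', ← comap_absIntegersMap_smul, hg])
  exact hc ((Subgroup.mul_mem_cancel_left H ⟨g, rfl⟩).mp (hDH hgc))

/-! ## Anticyclotomic towers: `κ(Frob_v) = 1` at a ramified `v ∤ p`; `D_v ≤ ker κ` -/

variable {p : ℕ} [Fact p.Prime]

/-- **Anticyclotomic `κ`: `κ φ = 1` for every Frobenius `φ` at every prime above a place `v ∤ p` of the
quadratic field `K` that is RAMIFIED over `ℚ`.** With `y ∈ I_𝔓(Γ_ℚ) ∖ res(Γ_K)`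
(`exists_mem_inertia_not_mem_range_of_ramificationIdx_eq_two`): `y·res φ·y⁻¹ = res φ'` for some
`φ' ∈ Γ_K` (`res(Γ_K)` has index `2`, hence is normal), `κ φ' = (κ φ)⁻¹` (anticyclotomic relation),
and `res(φ' φ⁻¹) = y · (res φ · y⁻¹ · res φ⁻¹) ∈ I_𝔓` (`res φ ∈ D_𝔓` normalises `I_𝔓`), so
`φ' φ⁻¹ ∈ I_𝔔 ≤ ker κ` (`ℤ_p`-extensions are unramified at `v ∤ p`); thus `κ φ = κ φ' = (κ φ)⁻¹`.
[cite: GreenbergLNM1716, §3 p. 87 (primes splitting completely)] [cite: Washington1997, Prop. 13.2 and §13.1] -/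
theorem IsAnticyclotomic.apply_eq_one_of_ramificationIdx_eq_two (hK : Module.finrank ℚ K = 2)
    {κ : ZpExtension K p} (hκ : κ.IsAnticyclotomic) {v : HeightOneSpectrum (𝓞 K)}
    (hpv : ((p : ℕ) : 𝓞 K) ∉ v.asIdeal) (he : v.asIdeal.ramificationIdx (𝓞 ℚ) = 2)
    {𝔔 : Ideal (absIntegers (𝓞 K) K)} (h𝔔 : 𝔔 ∈ v.primesAbove)
    {φ : absoluteGaloisGroup K} (hφ : IsArithFrobAt (𝓞 K) φ 𝔔) : κ φ = 1 := by
  haveI : FiniteDimensional ℚ K := Module.finite_of_finrank_eq_succ hK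
  haveI := h𝔔.1
  obtain ⟨y, hyI, hyH⟩ := exists_mem_inertia_not_mem_range_of_ramificationIdx_eq_two hK he h𝔔
  set 𝔓 := 𝔔.comap (absIntegersMap ℚ K) with h𝔓def
  -- `res φ ∈ D_𝔓`
  have hφD : absGaloisRestrict ℚ K φ ∈ 𝔓.decompositionSubgroup (absoluteGaloisGroup ℚ) := by
    have h1 : φ ∈ (𝔓.decompositionSubgroup (absoluteGaloisGroup ℚ)).comap
        (absGaloisRestrict ℚ K).toMonoidHom := by
      rw [h𝔓def, comap_decompositionSubgroup_comap_absIntegersMap]; exact hφ.mem_stabilizer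
    exact Subgroup.mem_comap.mp h1
  -- `φ'` with `res φ' = y · res φ · y⁻¹` (the image is normal of index two)
  obtain ⟨_, hHi⟩ :=
    Literature.NumberTheory.Automorphic.isOpen_range_absGaloisRestrict_and_index_eq_two ℚ K hK
  haveI hN : ((absGaloisRestrict ℚ K).range : Subgroup (absoluteGaloisGroup ℚ)).Normal :=
    Subgroup.normal_of_index_eq_two hHi
  obtain ⟨φ', hφ'⟩ : y * absGaloisRestrict ℚ K φ * y⁻¹ ∈ (absGaloisRestrict ℚ K).range :=
    hN.conj_mem _ ⟨φ, rfl⟩ y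
  change absGaloisRestrict ℚ K φ' = y * absGaloisRestrict ℚ K φ * y⁻¹ at hφ'
  -- the anticyclotomic relation
  have hinv : κ φ' = (κ φ)⁻¹ := hκ φ φ' y hyH hφ'
  -- `φ' φ⁻¹ ∈ I_𝔔 ≤ ker κ`
  have hI : absGaloisRestrict ℚ K (φ' * φ⁻¹) ∈ 𝔓.inertia (absoluteGaloisGroup ℚ) := by
    rw [map_mul, map_inv, hφ']
    have h2 : absGaloisRestrict ℚ K φ * y⁻¹ * (absGaloisRestrict ℚ K φ)⁻¹ ∈
        𝔓.inertia (absoluteGaloisGroup ℚ) :=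
      conj_mem_inertia_of_mem_decompositionSubgroup hφD ((𝔓.inertia _).inv_mem hyI)
    have h3 := (𝔓.inertia (absoluteGaloisGroup ℚ)).mul_mem hyI h2
    convert h3 using 1
    group
  have hI' : φ' * φ⁻¹ ∈ 𝔔.inertia (absoluteGaloisGroup K) := by
    rw [← comap_inertia_comap_absIntegersMap ℚ K 𝔔]
    exact Subgroup.mem_comap.mpr hI
  have hker : κ (φ' * φ⁻¹) = 1 :=
    ZpExtension.mem_kerSubgroup.mp (ZpExtension.inertia_le_kerSubgroup_holds K p κ hpv h𝔔 hI')
  rw [map_mul, map_inv, hinv, ← mul_inv, inv_eq_one] at hker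
  -- `κ φ · κ φ = 1` in the torsion-free `ℤ_p`
  have h : κ φ = (κ φ)⁻¹ := eq_inv_of_mul_eq_one_left hker
  exact multiplicative_padicInt_eq_one_of_eq_inv h

/-- **Places over RAMIFIED primes split completely in the anticyclotomic `ℤ_p`-extension**: for `K`
quadratic, `κ` anticyclotomic and a finite place `v ∤ p` with `e(v|ℓ) = 2`, the decomposition group
`D_v` (of the chosen prime above `v`) lies in `ker κ = Gal(K̄/K_∞)`.
[cite: GreenbergLNM1716, §3 p. 87 (primes splitting completely)] [cite: Washington1997, Prop. 13.2 and §13.1] -/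
theorem IsAnticyclotomic.decomp_le_kerSubgroup_of_ramificationIdx_eq_two (hK : Module.finrank ℚ K = 2)
    {κ : ZpExtension K p} (hκ : κ.IsAnticyclotomic) {v : HeightOneSpectrum (𝓞 K)}
    (hpv : ((p : ℕ) : 𝓞 K) ∉ v.asIdeal) (he : v.asIdeal.ramificationIdx (𝓞 ℚ) = 2) :
    decomp v ≤ κ.kerSubgroup := by
  obtain ⟨φ, hφ⟩ := exists_isArithFrobAt_of_mem_primesAbove_holds (adicCompletionPrime_mem_primesAbove K v)
  exact decomp_le_kerSubgroup_of_frob κ hpv hφ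
    (IsAnticyclotomic.apply_eq_one_of_ramificationIdx_eq_two hK hκ hpv he
      (adicCompletionPrime_mem_primesAbove K v) hφ)

variable {M : Type} [AddCommGroup M] [DistribMulAction (absoluteGaloisGroup K) M]
  [TopologicalSpace M] [DiscreteTopology M]

/-- **… hence Castella's AWAY condition at a place over a RAMIFIED prime DESCENDS from `K_∞` to `K`**
(any discrete `Γ_K`-module `M`; `K` quadratic, `κ` anticyclotomic, `v ∤ p` with `e(v|ℓ) = 2` — on an
erratum field: the place above the multiplicative prime `q ∣ d_K`): for `c ∈ H¹(⊤, M) = H¹(K, M)`,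
`res_{K→K_∞} c` is locally trivial at the chosen place above `v` iff `c` is locally trivial at `v`.
[cite: GreenbergLNM1716, §3 p. 87 (primes splitting completely)] [cite: Castella2018, Thm. 2.3 (arXiv:1704.06608 p. 5): the Tamagawa term runs over `w ∣ N⁺` only] -/
theorem IsAnticyclotomic.resOfLe_mem_awayKer_iff_of_ramificationIdx_eq_two
    (hK : Module.finrank ℚ K = 2) {κ : ZpExtension K p} (hκ : κ.IsAnticyclotomic)
    {v : HeightOneSpectrum (𝓞 K)} (hpv : ((p : ℕ) : 𝓞 K) ∉ v.asIdeal)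
    (he : v.asIdeal.ramificationIdx (𝓞 ℚ) = 2)
    (c : subgroupH1 (⊤ : Subgroup (absoluteGaloisGroup K)) M) :
    resOfLe M (le_top : κ.kerSubgroup ≤ ⊤) c ∈ awayKer κ.kerSubgroup M v ↔ c ∈ awayKer ⊤ M v :=
  resOfLe_mem_awayKer_iff_of_decomp_le v
    (IsAnticyclotomic.decomp_le_kerSubgroup_of_ramificationIdx_eq_two hK hκ hpv he) c

end Summit.BirchSwinnertonDyer.Rank1Residual.X11b.AcSelmer

end
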